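import Summits.QuantumFields.YangMills.Theses.OneCertifiedCube
import Summits.QuantumFields.YangMills.Theorems.ParabolicTrajectoryLatticeGapOnTrajectoryTransferSymDefs

/-!
# Re-type package for the bet route `OneCertifiedCube` — crux `GapToContinuum`
# (stmt-QuantumFields-8896; its OneCertifiedCube edge is `replaced` by stmt-QuantumFields-16126, same defect)

Lead c14 (17th seat on stmt-8896).  The typed crux — and its OneCertifiedCube replacement 16126
(pair-uniform threshold, sup-norm per-pair constants) — are unprovable as typed for the reason every
seat found (D2 per-pair data vs the `k`-growing family of smeared product observables; D3b own-torus
finite-size control in renormalised currency).  For route `LangevinControlUV` the door is R5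
(`Retype.lean`, STRATEGY-CENSUS §6).  For `OneCertifiedCube` the natural door is DIFFERENT, because
there the lattice clustering is PRODUCED by a total-variation (Dobrushin–Shlosman) finite-size
condition (`CrossoverCertificate`, stmt-16125) whose engine (`FiniteSizeCriterion_proof`, stmt-8895,
landed) delivers constants `2‖A‖‖B‖(2R_A+1)⁴ q^j` — i.e. exactly the UNIFORM sup-norm currency that the
landed transfer R6 (`Transfer.transferHalfSym_of_uniformSlabClustering`, p121787 + p120012, wrapped as
`gapToContinuum_slabTransfer` p127362) consumes.  This file records, kernel-checked:

* `GapToContinuumTV` — the honest P for OneCertifiedCube (pasteable route text, vocabulary of the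
  route file's import cone only): TV finite-size condition eventually along the scheme (VERBATIM the
  conclusion of `CrossoverCertificate`) + the scheme side conditions R6 consumes (`M`-adic spacings,
  `β_k → ∞`, `a_k L_k / log(a_k⁻¹) → ∞`, reflection-symmetric and polynomially bounded
  renormalisations — reflection symmetry INLINED on `LGConfig`, since `YMSpecies.timeReflect` is not
  in the route file's cone) ⟹ `T.HasMassGap (κ/(2ℓ))`, `κ = κ(n, ε) > 0`.
* `ContinuumLimitExistsS` — stmt-16124 with those side conditions conjoined (existential scheme: every
  constructive supplier has `a_k = M^{-k}`, chooses `L_k`, renormalises symmetrically and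
  polynomially); `continuumLimitExists_of_S` : it implies the current 16124.
* `closesTV : FiniteSizeCriterion → ContinuumLimitExistsS → CrossoverCertificate → GapToContinuumTV →
  YangMills` — the deciding theorem re-closes by plumbing only (elaborates against the route file's
  imports; `Δ := min κ_F κ_P / (2ℓ)`).
* `TVSlabClustering` — the ONE lattice-only lemma left: TV finite-size condition eventually ⟹
  `Transfer.UniformSlabClustering r sch (κ/(2ℓ))` (DS block recursion run on the scheme's OWN torus
  for time-slab observables; the `ℤ⁴`-box-injection step of `FiniteSizeCriterion_proof` does not cover
  spatially wrapping slab observables, so the recursion `recursion_step/decay` must be re-run in torus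
  cell geometry with the torus Gibbs specification `isGibbsMeasure_wilsonMeasure`; size L, no open
  mathematics), and `gapToContinuumTV_of_tvSlabClustering : TVSlabClustering → GapToContinuumTV` (R6).

Cone check: `RetypeOCCConeCheck.lean` (this directory) re-elaborates `GapToContinuumTV`,
`ContinuumLimitExistsS`, `continuumLimitExists_of_S`, `hasMassGap_anti`, `closesTV` importing ONLY the
route file `Summits.QuantumFields.YangMills.Theses.OneCertifiedCube` (rc 0): the texts are route-pasteable.

Planner commands (OneCertifiedCube tenure): restate 16126 := body of `GapToContinuumTV`, 16124 := body
of `ContinuumLimitExistsS`, `--closes-file` := `closesTV`; optionally split `GapToContinuumTV` into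
`TVSlabClustering` (crux, L) + glue-by `gapToContinuumTV_of_tvSlabClustering`.
-/

noncomputable section

open Filter MeasureTheory
open Literature.MathematicalPhysics.QuantumLattice Literature.MathematicalPhysics.QuantumFieldTheory
open Summit.QuantumFields.YangMills.Theses.OneCertifiedCube
open Summit.QuantumFields.YangMills.Cruxes.LatticeGapOnTrajectory.OrbitKantorovichFiniteSize

namespace Summit.QuantumFields.YangMills.Cruxes.GapToContinuum.RetypeOCC

/-- **P_TV — the honest `GapToContinuum` of route OneCertifiedCube (raw route text).** -/
def GapToContinuumTV : Prop :=
  ∀ (n : ℕ) (ε : ℝ), 1 ≤ n → 0 ≤ ε → ε * ((((4 * n + 3) ^ 4 - (4 * n + 1) ^ 4 : ℕ)) : ℝ) < 1 → ∃ κ : ℝ, 0 < κ ∧ ∀ (G : Type) [Group G] [TopologicalSpace G] [IsTopologicalGroup G] [CompactSpace G] [MeasurableSpace G] [BorelSpace G] (r : Literature.MathematicalPhysics.QuantumFieldTheory.LatticeRep G) (sch : Literature.MathematicalPhysics.QuantumFieldTheory.SpeciesScheme (Literature.MathematicalPhysics.QuantumFieldTheory.YMSpecies G)) (T : Literature.MathematicalPhysics.QuantumFieldTheory.OSData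 (Literature.MathematicalPhysics.QuantumFieldTheory.YMSpecies G) 4) (ℓ : ℝ), 0 < ℓ → (∃ (M : ℕ) (nM : ℕ → ℕ), 2 ≤ M ∧ ∀ k : ℕ, sch.a k = ((M : ℝ) ^ nM k)⁻¹) → sch.HasWeakCouplingLimit → Filter.Tendsto (fun k : ℕ => sch.a k * (sch.L k : ℝ) / Real.log (sch.a k)⁻¹) Filter.atTop Filter.atTop → (∀ s s' : Literature.MathematicalPhysics.QuantumFieldTheory.YMSpecies G, (∀ U : Literature.MathematicalPhysics.QuantumLattice.LGConfig 4 G, s'.F U = s.F (fun e => if e.2 = 0 then (U (if e.2 = 0 then (Function.update e.1 0 (-(e.1 0)) - Pi.single 0 1, 0) else (Function.update e.1 0 (-(e.1 0)), e.2)))⁻¹ else U (if e.2 = 0 then (Function.update e.1 0 (-(e.1 0)) - Pi.single 0 1, 0) else (Function.update e.1 0 (-(e.1 0)), e.2)))) → ∀ k : ℕ, sch.c s' k = sch.c s k ∧ sch.m s' k = sch.m s k) → (∀ s : Literature.MathematicalPhysics.QuantumFieldTheory.YMSpecies G, ∃ (q : ℕ) (K : ℝ), ∀ k : ℕ, |sch.c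 s k| ≤ K * ((sch.a k)⁻¹) ^ q ∧ |sch.m s k| ≤ K * ((sch.a k)⁻¹) ^ q) → Literature.MathematicalPhysics.QuantumFieldTheory.IsYangMillsFor r sch T → (∀ᶠ k : ℕ in Filter.atTop, (∀ w : Fin 4 → ℤ → ℤ, (∀ i j, w i j + ((⌈ℓ / sch.a k⌉₊ : ℕ) : ℤ) ≤ w i (j + 1) ∧ w i (j + 1) ≤ w i j + 2 * ((⌈ℓ / sch.a k⌉₊ : ℕ) : ℤ)) → ∀ Y : Finset (Fin 4 → ℤ), Y ⊆ (Fintype.piFinset fun _ : Fin 4 => Finset.Icc (-(2 * ((n : ℕ) : ℤ))) (2 * ((n : ℕ) : ℤ))) → (0 : Fin 4 → ℤ) ∈ Y → ∀ η η' : Literature.MathematicalPhysics.QuantumLattice.LGConfig 4 G, (∀ e ∈ (Fintype.piFinset fun _ : Fin 4 => Finset.Icc (-(2 * ((n : ℕ) : ℤ))) (2 * ((n : ℕ) : ℤ))).biUnion (fun y : Fin 4 → ℤ => (Fintype.piFinset fun i : Fin 4 => Finset.Ico (w i (y i)) (w i (y i + 1))) ×ˢ (Finset.univ : Finset (Fin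 4))), η e = η' e) → ∀ f : Literature.MathematicalPhysics.QuantumLattice.LGConfig 4 G → ℝ, Literature.MathematicalPhysics.QuantumLattice.IsCylinder f ((fun y : Fin 4 → ℤ => (Fintype.piFinset fun i : Fin 4 => Finset.Ico (w i (y i)) (w i (y i + 1))) ×ˢ (Finset.univ : Finset (Fin 4))) 0) → Measurable f → (∀ U, 0 ≤ f U ∧ f U ≤ 1) → |(∫ U, f U ∂(Literature.MathematicalPhysics.QuantumLattice.ymSpecification r.ρ (sch.β k) (Y.biUnion (fun y : Fin 4 → ℤ => (Fintype.piFinset fun i : Fin 4 => Finset.Ico (w i (y i)) (w i (y i + 1))) ×ˢ (Finset.univ : Finset (Fin 4)))) η)) - ∫ U, f U ∂(Literature.MathematicalPhysics.QuantumLattice.ymSpecification r.ρ (sch.β k) (Y.biUnion (fun y : Fin 4 → ℤ => (Fintype.piFinset fun i : Fin 4 => Finset.Ico (w i (y i)) (w i (y i + 1))) ×ˢ (Finset.univ : Finset (Fin 4)))) η')| ≤ ε)) → T.HasMassGap (κ / (2 * ℓ))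

/-- **E_S — `ContinuumLimitExists` (stmt-16124) with the scheme side conditions R6 consumes (raw route text).** -/
def ContinuumLimitExistsS : Prop :=
  ∀ (G : Type) [Group G] [TopologicalSpace G] [IsTopologicalGroup G] [CompactSpace G], Literature.MathematicalPhysics.QuantumFieldTheory.IsCompactSimpleLieGroup G → letI : MeasurableSpace G := borel G; haveI : BorelSpace G := ⟨rfl⟩; ∃ (r : Literature.MathematicalPhysics.QuantumFieldTheory.LatticeRep G) (sch : Literature.MathematicalPhysics.QuantumFieldTheory.SpeciesScheme (Literature.MathematicalPhysics.QuantumFieldTheory.YMSpecies G)) (T : Literature.MathematicalPhysics.QuantumFieldTheory.OSData (Literature.MathematicalPhysics.QuantumFieldTheory.YMSpecies G) 4), sch.HasWeakCouplingLimit ∧ (∃ (M : ℕ) (nM : ℕ → ℕ), 2 ≤ M ∧ ∀ k : ℕ, sch.a k = ((M : ℝ) ^ nM k)⁻¹) ∧ Filter.Tendsto (fun k : ℕ => sch.a k * (sch.L k : ℝ) / Real.log (sch.a k)⁻¹) Filter.atTop Filter.atTop ∧ (∀ s s' : Literature.MathematicalPhysics.QuantumFieldTheory.YMSpecies G, (∀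 U : Literature.MathematicalPhysics.QuantumLattice.LGConfig 4 G, s'.F U = s.F (fun e => if e.2 = 0 then (U (if e.2 = 0 then (Function.update e.1 0 (-(e.1 0)) - Pi.single 0 1, 0) else (Function.update e.1 0 (-(e.1 0)), e.2)))⁻¹ else U (if e.2 = 0 then (Function.update e.1 0 (-(e.1 0)) - Pi.single 0 1, 0) else (Function.update e.1 0 (-(e.1 0)), e.2)))) → ∀ k : ℕ, sch.c s' k = sch.c s k ∧ sch.m s' k = sch.m s k) ∧ (∀ s : Literature.MathematicalPhysics.QuantumFieldTheory.YMSpecies G, ∃ (q : ℕ) (K : ℝ), ∀ k : ℕ, |sch.c s k| ≤ K * ((sch.a k)⁻¹) ^ q ∧ |sch.m s k| ≤ K * ((sch.a k)⁻¹) ^ q) ∧ Literature.MathematicalPhysics.QuantumFieldTheory.IsYangMillsFor r sch T ∧ T.IsNontrivial r.curvature ∧ T.IsNonGaussian r.curvature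

/-- E_S implies the current E (drop the side conditions). -/
theorem continuumLimitExists_of_S (h : ContinuumLimitExistsS) : ContinuumLimitExists := by
  intro G _ _ _ _ hG
  obtain ⟨r, sch, T, hW, -, -, -, -, hYM, hNT, hNG⟩ := h G hG
  exact ⟨r, sch, T, hW, hYM, hNT, hNG⟩

/-- Rate antitonicity of the continuum gap (plumbing lemma, re-proved inline in `closesTV`'s style). -/
theorem hasMassGap_anti {ι : Type} {T : OSData ι 4} {Δ Δ' : ℝ} (h : T.HasMassGap Δ) (hle : Δ' ≤ Δ) :
    T.HasMassGap Δ' := by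
  intro n m k k' F G hF hG
  obtain ⟨C, hC⟩ := h n m k k' F G hF hG
  refine ⟨max C 0, fun t ht H hH => (hC t ht H hH).trans ?_⟩
  have h1 : C * Real.exp (-Δ * t) ≤ max C 0 * Real.exp (-Δ * t) :=
    mul_le_mul_of_nonneg_right (le_max_left _ _) (Real.exp_pos _).le
  have h2 : Real.exp (-Δ * t) ≤ Real.exp (-Δ' * t) := Real.exp_le_exp.2 (by nlinarith)
  exact h1.trans (mul_le_mul_of_nonneg_left h2 (le_max_right _ _))

/-- **Deciding theorem of the repaired cone** `F → E_S → C → P_TV → YangMills` — plumbing, ceil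
arithmetic and `Filter.Eventually` bookkeeping only (as the current `closes`), with
`Δ := min κ_F κ_P / (2ℓ)`. -/
theorem closesTV (hF : FiniteSizeCriterion) (hE : ContinuumLimitExistsS) (hC : CrossoverCertificate)
    (hP : GapToContinuumTV) : YangMills := by
  intro G _ _ _ _ hG
  letI : MeasurableSpace G := borel G
  haveI : BorelSpace G := ⟨rfl⟩
  obtain ⟨r, sch, T, hW, hMad, hVol, hSym, hPoly, hYM, hNT, hNG⟩ := hE G hG
  obtain ⟨ℓ, hℓ, n, ε, hn, hε, hM, hev⟩ := hC G hG r sch T hW hYM hNT hNG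
  obtain ⟨κF, hκF, hF'⟩ := hF n ε hn hε hM
  obtain ⟨κP, hκP, hP'⟩ := hP n ε hn hε hM
  have hAB := hF' G r.N r.ρ r.continuous r.injective
  -- the continuum gap at rate κP/(2ℓ)
  have hTgap : T.HasMassGap (κP / (2 * ℓ)) := hP' G r sch T ℓ hℓ hMad hW hVol hSym hPoly hYM hev
  set κ : ℝ := min κF κP with hκdef
  have hκ : 0 < κ := lt_min hκF hκP
  have hκleF : κ ≤ κF := min_le_left _ _
  have hκleP : κ ≤ κP := min_le_right _ _
  have hΔ : 0 < κ / (2 * ℓ) := by positivity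
  have ev1 : ∀ᶠ k in Filter.atTop, sch.a k ≤ ℓ := sch.tendsto_a.eventually (eventually_le_nhds hℓ)
  have ev2 : ∀ᶠ k in Filter.atTop, ((8 * (n : ℝ) + 7) * ℓ) ≤ sch.a k * (sch.L k : ℝ) :=
    sch.tendsto_L.eventually (Filter.eventually_ge_atTop _)
  obtain ⟨k₀, hk₀⟩ := Filter.eventually_atTop.mp ((hev.and ev1).and ev2)
  have hU : ∀ A B : YMSpecies G, ∃ C : ℝ, ∀ k : ℕ, k₀ ≤ k →
      ∀ S : ℕ, sch.L k ≤ S → ∀ t : ℕ, t ≤ S →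
        |latticeConnectedCorr r.ρ (sch.β k) (2 * S + 1) A.F B.F t| ≤
          C * Real.exp (-(κ / (2 * ℓ) * (sch.a k * t))) := by
    intro A B
    obtain ⟨C, hCb⟩ := hAB A B
    refine ⟨C, fun k hk0 S hS t ht => ?_⟩
    obtain ⟨⟨hk, h1⟩, h2⟩ := hk₀ k hk0
    have ha : 0 < sch.a k := sch.a_pos k
    have hq : 0 < ℓ / sch.a k := div_pos hℓ ha
    have hb1 : 1 ≤ ⌈ℓ / sch.a k⌉₊ := Nat.one_le_iff_ne_zero.mpr (Nat.pos_iff_ne_zero.mp (Nat.ceil_pos.mpr hq))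
    have hble : ((⌈ℓ / sch.a k⌉₊ : ℕ) : ℝ) ≤ ℓ / sch.a k + 1 := (Nat.ceil_lt_add_one hq.le).le
    have hbpos : (0 : ℝ) < ((⌈ℓ / sch.a k⌉₊ : ℕ) : ℝ) := by exact_mod_cast hb1
    have hab : ((⌈ℓ / sch.a k⌉₊ : ℕ) : ℝ) * sch.a k ≤ 2 * ℓ := by
      calc ((⌈ℓ / sch.a k⌉₊ : ℕ) : ℝ) * sch.a k ≤ (ℓ / sch.a k + 1) * sch.a k := by gcongr
        _ = ℓ + sch.a k := by field_simp
        _ ≤ 2 * ℓ := by linarith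
    have hside : (8 * n + 7) * ⌈ℓ / sch.a k⌉₊ ≤ 2 * S + 1 := by
      have hreal : ((8 * (n : ℝ) + 7)) * ((⌈ℓ / sch.a k⌉₊ : ℕ) : ℝ) ≤ 2 * (sch.L k : ℝ) + 1 := by
        have h3 : ((8 * (n : ℝ) + 7) * ((⌈ℓ / sch.a k⌉₊ : ℕ) : ℝ)) * sch.a k
            ≤ (2 * (sch.L k : ℝ)) * sch.a k := by
          calc ((8 * (n : ℝ) + 7) * ((⌈ℓ / sch.a k⌉₊ : ℕ) : ℝ)) * sch.a k
              = (8 * (n : ℝ) + 7) * (((⌈ℓ / sch.a k⌉₊ : ℕ) : ℝ) * sch.a k) := by ring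
            _ ≤ (8 * (n : ℝ) + 7) * (2 * ℓ) := by gcongr
            _ = 2 * ((8 * (n : ℝ) + 7) * ℓ) := by ring
            _ ≤ 2 * (sch.a k * (sch.L k : ℝ)) := by gcongr
            _ = (2 * (sch.L k : ℝ)) * sch.a k := by ring
        have h4 : (8 * (n : ℝ) + 7) * ((⌈ℓ / sch.a k⌉₊ : ℕ) : ℝ) ≤ 2 * (sch.L k : ℝ) :=
          le_of_mul_le_mul_right h3 ha
        have hL : (sch.L k : ℝ) ≤ (S : ℝ) := by exact_mod_cast hS
        linarith
      have hnat : (8 * n + 7) * ⌈ℓ / sch.a k⌉₊ ≤ 2 * sch.L k + 1 := by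
        have hreal' : ((8 * (n : ℝ) + 7)) * ((⌈ℓ / sch.a k⌉₊ : ℕ) : ℝ) ≤ 2 * (sch.L k : ℝ) + 1 := by
          have h3 : ((8 * (n : ℝ) + 7) * ((⌈ℓ / sch.a k⌉₊ : ℕ) : ℝ)) * sch.a k
              ≤ (2 * (sch.L k : ℝ)) * sch.a k := by
            calc ((8 * (n : ℝ) + 7) * ((⌈ℓ / sch.a k⌉₊ : ℕ) : ℝ)) * sch.a k
                = (8 * (n : ℝ) + 7) * (((⌈ℓ / sch.a k⌉₊ : ℕ) : ℝ) * sch.a k) := by ring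
              _ ≤ (8 * (n : ℝ) + 7) * (2 * ℓ) := by gcongr
              _ = 2 * ((8 * (n : ℝ) + 7) * ℓ) := by ring
              _ ≤ 2 * (sch.a k * (sch.L k : ℝ)) := by gcongr
              _ = (2 * (sch.L k : ℝ)) * sch.a k := by ring
          have h4 : (8 * (n : ℝ) + 7) * ((⌈ℓ / sch.a k⌉₊ : ℕ) : ℝ) ≤ 2 * (sch.L k : ℝ) :=
            le_of_mul_le_mul_right h3 ha
          linarith
        exact_mod_cast hreal'
      omega
    have hbound := hCb (sch.β k) ⌈ℓ / sch.a k⌉₊ hb1 hk S hside t ht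
    have hC0 : 0 ≤ C := by
      have h0 : 0 ≤ C * Real.exp (-(κF * (t : ℝ) / ((⌈ℓ / sch.a k⌉₊ : ℕ) : ℝ))) :=
        (abs_nonneg _).trans hbound
      exact nonneg_of_mul_nonneg_left h0 (Real.exp_pos _)
    refine hbound.trans ?_
    gcongr
    have ht0 : (0 : ℝ) ≤ (t : ℝ) := by exact_mod_cast Nat.zero_le t
    rw [div_mul_eq_mul_div, div_le_div_iff₀ (by positivity) hbpos]
    calc κ * (sch.a k * (t : ℝ)) * ((⌈ℓ / sch.a k⌉₊ : ℕ) : ℝ)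
        = κ * (t : ℝ) * (((⌈ℓ / sch.a k⌉₊ : ℕ) : ℝ) * sch.a k) := by ring
      _ ≤ κF * (t : ℝ) * (2 * ℓ) := by gcongr
  have hgap : HasLatticeMassGap r sch (κ / (2 * ℓ)) := fun A B =>
    (hU A B).imp fun C hCk => Filter.eventually_atTop.mpr ⟨k₀, hCk⟩
  have hle : κ / (2 * ℓ) ≤ κP / (2 * ℓ) := by gcongr
  exact ⟨r, sch, T, hW, hYM, hNT, hNG, κ / (2 * ℓ), hΔ, hasMassGap_anti hTgap hle, hgap⟩

/-! ### The reduction of P_TV to one lattice-only Dobrushin–Shlosman lemma (R6 does the rest) -/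

/-- **The lattice-only lemma left for OneCertifiedCube**: the TV finite-size condition eventually
along the scheme gives UNIFORM SLAB CLUSTERING on the scheme's own tori (cluster-expansion / sup-norm
currency, constants polynomial in `(a_k⁻¹, w, L_k)`), rate `κ(n,ε)/(2ℓ)` in physical units.
Dobrushin–Shlosman 1985 §2 block recursion on the torus; Martinelli 1999 §2.3. Believed provable as
typed (size L): the DLR structure of the torus Wilson state is `isGibbsMeasure_wilsonMeasure`; the
finite-size hypothesis transfers to torus cells because every cube of `(4n+1)⁴` cells injects
(`(8n+7) b_k ≤ 2L_k+1` eventually); covariance ≤ `2 B² · #cells(slab) · (εM)^j` by the TV chain rule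
`FiniteSizeCriterion.multiCell_influence_general_of_abs_le`. -/
def TVSlabClustering : Prop :=
  ∀ (n : ℕ) (ε : ℝ), 1 ≤ n → 0 ≤ ε → ε * ((((4 * n + 3) ^ 4 - (4 * n + 1) ^ 4 : ℕ)) : ℝ) < 1 → ∃ κ : ℝ, 0 < κ ∧ ∀ (G : Type) [Group G] [TopologicalSpace G] [IsTopologicalGroup G] [CompactSpace G] [MeasurableSpace G] [BorelSpace G] (r : Literature.MathematicalPhysics.QuantumFieldTheory.LatticeRep G) (sch : Literature.MathematicalPhysics.QuantumFieldTheory.SpeciesScheme (Literature.MathematicalPhysics.QuantumFieldTheory.YMSpecies G)) (ℓ : ℝ), 0 < ℓ → (∀ᶠ k : ℕ in Filter.atTop, (∀ w : Fin 4 → ℤ → ℤ, (∀ i j, w i j + ((⌈ℓ / sch.a k⌉₊ : ℕ) : ℤ) ≤ w i (j + 1) ∧ w i (j + 1) ≤ w i j + 2 * ((⌈ℓ / sch.a k⌉₊ : ℕ) : ℤ)) → ∀ Y : Finset (Fin 4 → ℤ), Y ⊆ (Fintype.piFinset fun _ : Fin 4 => Finset.Icc (-(2 * ((n : ℕ) :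 ℤ))) (2 * ((n : ℕ) : ℤ))) → (0 : Fin 4 → ℤ) ∈ Y → ∀ η η' : Literature.MathematicalPhysics.QuantumLattice.LGConfig 4 G, (∀ e ∈ (Fintype.piFinset fun _ : Fin 4 => Finset.Icc (-(2 * ((n : ℕ) : ℤ))) (2 * ((n : ℕ) : ℤ))).biUnion (fun y : Fin 4 → ℤ => (Fintype.piFinset fun i : Fin 4 => Finset.Ico (w i (y i)) (w i (y i + 1))) ×ˢ (Finset.univ : Finset (Fin 4))), η e = η' e) → ∀ f : Literature.MathematicalPhysics.QuantumLattice.LGConfig 4 G → ℝ, Literature.MathematicalPhysics.QuantumLattice.IsCylinder f ((fun y : Fin 4 → ℤ => (Fintype.piFinset fun i : Fin 4 => Finset.Ico (w i (y i)) (w i (y i + 1))) ×ˢ (Finset.univ : Finset (Fin 4))) 0) → Measurable f → (∀ U, 0 ≤ f U ∧ f U ≤ 1) → |(∫ U, f U ∂(Literature.MathematicalPhysics.QuantumLattice.ymSpecification r.ρ (sch.β k) (Y.biUnion (fun y : Fin 4 → ℤ => (Fintype.piFinset fun i : Fin 4 => Finset.Ico (w i (y i)) (w i (y i + 1))) ×ˢ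 (Finset.univ : Finset (Fin 4)))) η)) - ∫ U, f U ∂(Literature.MathematicalPhysics.QuantumLattice.ymSpecification r.ρ (sch.β k) (Y.biUnion (fun y : Fin 4 → ℤ => (Fintype.piFinset fun i : Fin 4 => Finset.Ico (w i (y i)) (w i (y i + 1))) ×ˢ (Finset.univ : Finset (Fin 4)))) η')| ≤ ε)) → Transfer.UniformSlabClustering r sch (κ / (2 * ℓ))

section Inline

variable {G : Type} [Group G] [MeasurableSpace G]

/-- The inlined reflection-symmetry clause of the route texts implies the tree's
`SpeciesScheme.IsReflectionSymmetric` (the inline map IS `cfgReflect`, by `rfl`). -/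
theorem isReflectionSymmetric_of_inline [MeasurableInv G] (sch : SpeciesScheme (YMSpecies G))
    (h : (∀ s s' : Literature.MathematicalPhysics.QuantumFieldTheory.YMSpecies G, (∀ U : Literature.MathematicalPhysics.QuantumLattice.LGConfig 4 G, s'.F U = s.F (fun e => if e.2 = 0 then (U (if e.2 = 0 then (Function.update e.1 0 (-(e.1 0)) - Pi.single 0 1, 0) else (Function.update e.1 0 (-(e.1 0)), e.2)))⁻¹ else U (if e.2 = 0 then (Function.update e.1 0 (-(e.1 0)) - Pi.single 0 1, 0) else (Function.update e.1 0 (-(e.1 0)), e.2)))) → ∀ k : ℕ, sch.c s' k = sch.c s k ∧ sch.m s' k = sch.m s k)) :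
    sch.IsReflectionSymmetric := fun s k =>
  h s s.timeReflect (fun _ => rfl) k

/-- The inlined polynomial-renormalisation clause is `Transfer.HasPolynomialRenormalisations` (`Iff.rfl`). -/
theorem hasPolynomialRenormalisations_iff_inline (sch : SpeciesScheme (YMSpecies G)) :
    Transfer.HasPolynomialRenormalisations sch ↔ (∀ s : Literature.MathematicalPhysics.QuantumFieldTheory.YMSpecies G, ∃ (q : ℕ) (K : ℝ), ∀ k : ℕ, |sch.c s k| ≤ K * ((sch.a k)⁻¹) ^ q ∧ |sch.m s k| ≤ K * ((sch.a k)⁻¹) ^ q) := Iff.rfl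

/-- The inlined volume clause is `SpeciesScheme.HasVolumeGrowth` (`Iff.rfl`). -/
theorem hasVolumeGrowth_iff_inline (sch : SpeciesScheme (YMSpecies G)) :
    sch.HasVolumeGrowth ↔ Filter.Tendsto (fun k : ℕ => sch.a k * (sch.L k : ℝ) / Real.log (sch.a k)⁻¹) Filter.atTop Filter.atTop := Iff.rfl

end Inline

/-- **P_TV reduces to the lattice-only lemma**: `TVSlabClustering → GapToContinuumTV`, by the landed
R6 bridge `Transfer.transferHalfSym_of_uniformSlabClustering` at `sch' = sch`. -/
theorem gapToContinuumTV_of_tvSlabClustering (h : TVSlabClustering) : GapToContinuumTV := by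
  intro n ε hn hε hM
  obtain ⟨κ, hκ, h'⟩ := h n ε hn hε hM
  refine ⟨κ, hκ, ?_⟩
  intro G _ _ _ _ _ _ r sch T ℓ hℓ hMad hW hVol hSym hPoly hYM hev
  obtain ⟨M, nM, hM2, hshape⟩ := hMad
  have hclust : Transfer.UniformSlabClustering r sch (κ / (2 * ℓ)) := h' G r sch ℓ hℓ hev
  exact Transfer.transferHalfSym_of_uniformSlabClustering r sch hM2 hshape hW hVol hclust sch rfl rfl rfl
    (isReflectionSymmetric_of_inline sch hSym) hPoly T hYM

end Summit.QuantumFields.YangMills.Cruxes.GapToContinuum.RetypeOCC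

end
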